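import Literature.MathematicalPhysics.QuantumFieldTheory.Balaban1983to89.B8Ineq192MultiLevelTorusL0
import Literature.MathematicalPhysics.QuantumFieldTheory.Balaban1983to89.B6Geom246MultiLevelBoxL0
import Literature.MathematicalPhysics.QuantumFieldTheory.Balaban1983to89.B6Geom246MultiLevelTorusL0
import Literature.MathematicalPhysics.QuantumFieldTheory.Balaban1983to89.B6Ineq268MultiLevelBoxL0
import Literature.MathematicalPhysics.QuantumFieldTheory.Balaban1983to89.B6MultiLevelBoxOperatorL0
import Literature.MathematicalPhysics.QuantumFieldTheory.Balaban1983to89.B6MultiLevelTorusOperatorL0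
/-!
# `Balaban1983to89.B9Ineq349MultiLevelTorusL0` — LEVEL-0 TWIN (programme G-F3′-L0, sub-row G-F3′-L0∕B8 «N05 cone»; director-ym LINE №27 ∕ №35, UV3-NODE §24.5; plan `lit-balaban-r03/G-F3L0-PLAN.md`, row log `lit-balaban-lead/ROW-G-F3p-L0.md` §7) of `B9Ineq349MultiLevelTorus`:
the same declarations, SAME NAMES AND STATEMENTS, for nested families WITH print's region `Λ₀ = T ∖ Ω₁` ADMITTED (structures
`B6MultiLevelBoxOperatorL0.Domains` / `B6MultiLevelTorusOperatorL0.TDomains`: levels `0, …, k`, the level-`0` block a single site, `Q′₀ = id`,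
finite weight `a₀` — print p.225 (2.14) «Σ_{j=0}^k … (Q′₀λ)(x) = λ(x), x ∈ Λ₀», p.229 «taking a sequence (2.1) … smallest possible domains B^j(Λ_j),
and considering the operator Δ_a defined by (2.19), (2.20) for this sequence»).  Every `D`-free object is the lineage's, consumed BY NAME; no existing
module is touched; no fact is minted.  Unit `lit-balaban-p38` (p38 gen 36; second hand of sub-row G-F3′-L0∕B8 «N05 cone» — director-ym №35 2026-08-27T23:07:41Z, OWNER `lit-balaban-r05`, consumer pub-ymgap∕dag-n05-c by endpoint name; port discipline and tooling r03 gen 36∕37, PLAN v1.5); B8 fold owner r05, B9 fold owner r06; referee ref-4.  THE TWIN'S DOCUMENTATION FOLLOWS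
VERBATIM (its «levels 1 … k» / «Ω₁ = X» sentences describe the twin; here `j` runs from `0` and `Ω₁` may be a proper subset).

# `Balaban1983to89.B9Ineq349MultiLevelTorus` — T. Bałaban, *Propagators for lattice gauge theories in a background field*, Commun.
# Math. Phys. **99** (1985) 389–434 [Balaban1985BackgroundPropagators], **(3.49)** p. 399 «|P(x,x′)|, |(DP)_μ(x,x′)|, |(PD\*)_ν(x,x′)|,
# |(DPD\*)_{μν}(x,x′)| ≦ O(1)[1, (Lʲη)⁻¹, (Lʲη)⁻¹, (Lʲη)⁻²](L^{j′}η)^{−d}e^{−½δ₀d(y,y′)}» for `P = I − R = G′Q′\*(Q′G′²Q′\*)⁻¹Q′G′` ((3.25))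
# **AT U = 1 ON PRINT'S CARRIER: THE GENUINE `k`-LEVEL NESTED-DOMAIN TORUS FAMILY `T_η = Ω₁ ⊃ … ⊃ Ω_k` OF [B6] §2, ALL FOUR
# ENTRIES, WITH THE GENUINE LEVEL PREFACTORS**, the [B6] Prop. 2.2 majorants of `G′`, `∇G′` and the inverse `(Q′G′²Q′\*)⁻¹`
# entering BY THEIR PRINTED PROPERTIES — p. 399: «This way the theorems are reduced to the corresponding theorems for propagators
# without external gauge field. They were proved in [4].»

statement-level skeleton of published theorems with citation tags; proofs where landed; nothing here is a claim about the Yang–Mills mass gap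

PDF held: `paper:balaban1985-cmp99-background-propagators` (journal page = PDF page + 388); text layer of p. 399 [PDF 11] l. 5–9 ((3.49)
and «using again Lemma 2.1»), l. 30–32 («reduced to the corresponding theorems for propagators without external gauge field. They
were proved in [4].») and p. 394 [PDF 6] (3.25), as re-read by this seat's lineage for the Neumann-box twin `B9Ineq349MultiLevelBox`
(gen 44); the display (3.49) itself was read as an image earlier (`B9Ineq349FlatTorus`).

CITATION HEADER (lean-in-tree rule).  Cell `lit-balaban` (HOME `run/shared/lean/pub/lit-balaban/`), unit `lit-balaban-r05` gen 54
(B8 reader/typer; free-target protocol G.5-34(d), TAKING HOME/STATUS 2026-08-22; courtesy instance in the B9 block — owner r06,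
whose rows B9.Eq3.49 / B9.Eq3.25 keep their heads: the general-background (3.49) is r06's theorem on [4]-shaped letters
`B9Ineq349Hom.ineq349_hom` / `B9Thm34RFinal` / `B9Thm34PKernelFinal`).  WHAT IS REPRODUCED = the display (3.49) at the flat
background U = 1 in the MULTI-LEVEL geometry of [B6] §2 ON THE TORUS — after the Neumann-box instance `B9Ineq349MultiLevelBox`
(p334945; an arbitrary nested family of a Neumann BOX) this module proves (3.49) WITH ITS LEVEL PREFACTORS
`[1, (Lʲη)⁻¹, (Lʲη)⁻¹, (Lʲη)⁻²](L^{j′}η)^{−(d+1)}` (spatial dimension `d + 1`, lattice units η = 1) for the GENUINE `k`-level operator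
`G′ = Δ′_a⁻¹ = B6MultiLevelTorusOperator.gmlT` of seat p21's TORUS carrier (CMP 96 §2 on `T_η`, p. 224 «we admit the case when some
domains Ω_j are equal to T_η»; nested family `D : TDomains d ℓ M_h k P R`), `Q′ = B6Ineq268MultiLevelBoxL0.QB D.toDomains` /
`Q′\* = QsB D.toDomains`, `D_μ` = ANY family `Dd μ` of fine-lattice matrices carrying the second-entry majorant (p21's periodic
forward difference `B6Prop22DerivMultiLevelTorus.dT N₀ μ` = the covariant derivative (3.3) at U = 1 is the intended instance) and
`D\*_ν = (Dd ν)ᵀ` (its adjoint for the natural scalar product, p. 391 — the transpose at η = 1).  TWO KINDS OF ANALYTIC INPUT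
ENTER AS ARGUMENTS (the device of `B8Ineq192MultiLevelTorus` (p342575) / `B9Ineq349MultiLevelBox`; D-0026: hypotheses of theorems,
no `… : Prop` fact minted): (a) the [B6] Prop. 2.2 majorants of `G′` and `Dd μ·G′` on the torus geometry — first and second entries
of (2.67), in the `HasMajorant` shapes of p21's `B6Prop22MultiLevelTorusL0.prop22_first_multiLevelTorus` (p342287 ✓) and
`B6Prop22DerivMultiLevelTorusL0.prop22_second_multiLevelTorus` (staged READY in `lit-balaban-p21/lean/`, filing); (b) the inverse
`(Q′G′²Q′\*)⁻¹` of (3.25) as an operator `G` on `𝔅` carrying the kernel bound (2.87)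
`|G(y, y′)| ≦ C₁(Lʲη)⁻⁴(L^{j′}η)^{−(d+1)}e^{−½δ₁d_T(y,y′)}` (and, for `P² = P` only, the identity `(Q′G′²Q′\*)G = 1`).  When p21's Deriv
file is in the tree a short corollary discharges (a) by name; (b) waits for a torus Prop. 2.3.  Kind «kernel-checked proof of a
model instance»; one definition with body (`pProjMLT` = the word (3.25) for P on these carriers); every input BY NAME; 0 sorry.

WHAT IS PRINTED (verbatim).  p. 399 [PDF 11]: *"These theorems imply all the properties of the operator R, or DRD\*, we will
need in the future. For the operator P = I − R we obtain, using again Lemma 2.1, [|P(x, x′)|, |(DP)_μ(x, x′)|, |(PD\*)_ν(x, x′)|,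
|(DPD\*)_{μν}(x, x′)|] ≦ O(1)[1, (Lʲη)⁻¹, (Lʲη)⁻¹, (Lʲη)⁻²](L^{j′}η)^{−d}e^{−½δ₀d(y,y′)} for x ∈ Δ(y), y ∈ Λ_j, x′ ∈ Δ(y′), y′ ∈ Λ_{j′}.
(3.49) We have also the corresponding bounds for Hölder norms of the kernel (DPD\*)_{μν}(x, x′). Thus the operator Δ_a is well
defined."*; same page: *"This way the theorems are reduced to the corresponding theorems for propagators without external gauge
field. They were proved in [4]."*; p. 394 [PDF 6]: *"Rf = (I − G′Q′\*(Q′G′²Q′\*)⁻¹Q′G′)f, (3.25) where G′ = G′(U) = (Δ′_a)⁻¹"*;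
p. 391 [PDF 3]: *"The adjoints are taken with respect to natural L² scalar products"*.  [B6] = [4] of the paper = T. Bałaban,
*Propagators and renormalization transformations for lattice gauge theories. II*, CMP **96** (1984) 223–250
[Balaban1984PropagatorsII]: p. 224 «we admit the case when some domains Ω_j are equal to T_η»; Prop. 2.2 (2.67) p. 234 (the `G′`,
`∇G′` entries), Prop. 2.3 (2.87) p. 238, Lemma 2.1 (2.60)–(2.61) p. 234, the composition rule (2.52)–(2.55) p. 232 and the scale sum
(2.68) p. 235; p. 225 (2.13)–(2.14): `Δ′_a` is a quadratic form (so `G′ᵀ = G′`, `B6MultiLevelTorusOperator.gmlT_isSymm`).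

WHAT THIS FILE PROVES (kernel; axioms standard).  Setting of `B8Ineq192MultiLevelTorus`: the torus `T_η = ↥(boxDom N₀)` in lattice
units (η = 1, spatial dimension `d + 1`, `L = ℓ + 1`), nested torus family `D`, blocks `𝔅 = bset D.toDomains`, block map
`y(x) = blkOf D.toDomains x` (level `j = D.lev x`), lengths `(geomT D).len y = Lʲ`, pairing weights `W D.toDomains y = (Lʲ)^{d+1}`,
torus multiscale distance `d_T = (geomT D).dist` (2.46), its Lemma 2.1 `lemma21_torus` (T3), `geomTB`/`levelSepTB` ((2.60)).
* §1 **`pProjMLT D a G`** := G′∘(Q′\*∘G∘Q′)∘G′ with `G′ = gmlT` — the printed word for `P = I − R`; `rProjMLT_eq_one_sub_pProjMLT`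
  (the `R` of `B8Ineq192MultiLevelTorus` §5 IS `1 − pProjMLT`); `pProjMLT_idem` (`P² = P`) and `pProjMLT_rProjMLT` (`PR = 0`) from
  `(Q′G′²Q′\*)·G = 1`; the matrix entries written out (`pProjMLT_single`, `pProjMLT_transpose_single`) via THE SYMMETRY STEP
  `col_gmlT_eq_row` / `col_gmlT_transpose_eq_row` (`G′ᵀ = G′` on the torus).
* §2 `rowBlockSum_le_of_hasMajorantT`, `abs_QB_row_leT` (the `(L^{j′}η)^{−d}` gain of `Q′` on a ROW), on the torus geometry.
* §3 **`pKernel_decay_T`** — the engine run for one word `T·Q′\*G Q′·row_{x′}S` ON THE TORUS, for ALL `C, δ₀, C₁, δ₁ > 0`: constants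
  `ρ, B > 0`, `N₁ ≥ 1` such that for every member with `R·L·M_h ≥ N₁ + 1`, every `G` with the (2.87)-bound, every left factor `T`
  with majorant `C(Lʲ)^{m}e^{−½δ₀d_T}` and fine matrix `S` with majorant `C(Lʲ)^{n}e^{−½δ₀d_T}` (`m, n ≤ 2`):
  `|T(Q′\*(G(Q′(row_{x′}S))))(x)| ≦ B·(Lʲ)^{m+n}((Lʲ)⁴)⁻¹·W(y(x′))⁻¹·e^{−ρd_T(y(x),y(x′))}` — (2.87) on the column, weights moved by (2.60)
  (`inv_pow_lenT_le`/`pow_lenT_le`), middle points summed by (2.61) (`lemma21_torus`), rates by (2.54).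
* §4 **`ineq349_multiLevelTorus`** — **(3.49) AT U = 1 ON THE `k`-LEVEL TORUS FAMILY, ALL FOUR ENTRIES, GENUINE PREFACTORS**, under
  the first/second-entry majorant hypotheses and the (2.87)-bound; `ineq349_multiLevelTorus_R` (the same for `R − 1 = −P`).

HONEST SCOPE / NOT CLAIMED.  (i) Neither `G′`'s Prop.-2.2 majorants nor `(Q′G′²Q′\*)⁻¹` are constructed here: ARGUMENTS constrained by
the printed shapes (hence no `M_h ≥ 3`, «M large», `P_μ ≥ 4` or weight-window hypothesis — those belong to Prop. 2.2 and enter the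
discharging corollary); the theorems are CONDITIONAL on inhabitants — entry 1 is p21's `prop22_first_multiLevelTorus` (in the tree),
entry 2 p21's Deriv file (READY), the inverse a torus Prop. 2.3 not yet begun.  (ii) U = 1 only (no external gauge field, scalar
fibre), levels `1 … k` with `Ω₁ = T_η`, lattice units, `m² = 0` — the «propagators without external gauge field» of p. 399 on print's
carrier; the general (3.49) (admissible {Ω_j}, a background `U` with (3.35)) is r06's theorem on Theorem-3.1/3.2-shaped letters —
untouched, heads unchanged.  (iii) The Hölder clause is not treated.  (iv) `x ∈ Δ(y), y ∈ Λ_j` is read at the point's own block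
`y(x)` and level `j = D.lev x`; `D\*` = transpose (= adjoint for the uniform pairing at η = 1).  (v) Constants existential and crude
(functions of `d, ℓ, C, δ₀, C₁, δ₁`), `ρ = min(δ₀, δ₁)/16`; the (2.61) constant is the `L`-dependent `K261` (GAPS G-A11-1); «RM
sufficiently large» is the explicit threshold `N₁`.  (vi) NOT summit progress, NOT continuum, NOT Clay.

RELATED IN THE TREE, NOT DUPLICATED (stem check 2026-08-22T22:30Z: `ls Balaban1983to89 | grep -i 349` = `B9Ineq349`, `B9Ineq349FlatTorus`
(ONE scale, hypothesis-free), `B9Ineq349Hom` / `B9Ineq349PConcrete` (r06, (3.49) from Thm 3.1/3.2 letters), `B9Ineq349MultiLevelBox[P23]`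
(the Neumann-box twin); no multi-level torus instance): all cited BY NAME, nothing restated; `B8Ineq192MultiLevelTorus` (r05 g54:
`rProjMLT` = (3.25) on these carriers, `geomTB`, the torus scale absorption) and the abstract engine of `B8Ineq192MultiLevelBox`
(`levelConv_le`, `abs_apply_le_of_levelBound`, `ineq261With_of_le`) are the imports.
-/

namespace Literature.MathematicalPhysics.QuantumFieldTheory.Balaban1983to89.B9Ineq349MultiLevelTorusL0

open Finset Matrix
open B4Reflection242 (boxDom)
open B6MultiLevelBoxOperator hiding Domains mlOp_apply
open B6MultiLevelBoxOperatorL0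
open B6Geom246MultiLevelBox hiding Touch blkOf blkOf_corner blkOf_eq_iff_blk blkOf_eq_of_blk_i_eq blkOf_val bond bond_adj bset cen connected coord_bounds corner corner_mem csys dist_blkOf_le_box dist_blkOf_le_coord dist_blkOf_le_line dist_cen_le_of_adj dist_cen_le_of_touch dist_le_one_of_near dist_toR_cen_le exists_blkOf_eq geom lemma21_box lev_corner lev_eq_of_blkOf_eq levelGap pack reachable_blkOf reachable_of_near realizes scale_bounds touch_symm triangle_refl_nonneg walk_disp
open B6Geom246MultiLevelBoxL0
open B6MultiLevelTorusOperator hiding TDomains mlOpT_apply mlOpT_eq_reindex_chart mlOpT_mul_reindex mlOpT_tshift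
open B6MultiLevelTorusOperatorL0
open B6Geom246MultiLevelTorus hiding TouchT blkHom blkMap blkMap_blkOf blkMap_injective blkMap_surjective blkOf_tshift_eq bondT bondT_adj bond_le_bondT connectedT csysT distT_le_dist_box distT_le_dist_chart dist_posT_le_of_adj dist_posT_le_of_touchT dist_site_posT_le geomT label_bounds lemma21_torus levelGapT packT posT realizesT touchT_symm triangle_refl_nonneg_T walk_dispT
open B6Geom246MultiLevelTorusL0
open B6Ineq268MultiLevelBox hiding QB QB_apply QsB QsB_apply W W_eq W_pos Xk abs_qB abs_qB_le card_blkOf_le csysB geomB geomB_L geomB_M geomB_R geomB_RM geomB_RM_nonneg geomB_Site geomB_dist geomB_eta geomB_len geom_len ineq268_multiLevelBox instDecidableEqGeomBSite kerOp_Xk levelSepB qB qB_ne_zero realizesB refl_nonnegB sum_abs_qB_le symmB triangleB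
open B6Ineq268MultiLevelBoxL0
open B6RandomWalk (HasMajorant BlockSupp hasMajorant_mono)
open B6Ineq261LevelGap (K261 K261_nonneg theta_lt_one_of_log)
open B6Ineq243TwoLevelBox (aNext)
open B6Expansion282 (kerOp)
open B6Prop23Chain (mat apply_eq_sum_mat)
open B8Ineq192MultiLevelBox (abs_apply_le_of_levelBound levelConv_le ineq261With_of_le)
open B8Ineq192MultiLevelTorusL0

noncomputable section

variable {d : ℕ}

/-! ## §1  `P = I − R = G′Q′*·G·Q′G′` on the `k`-level torus family; the matrix entries; the symmetry step `G′ᵀ = G′` -/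

section PProj

variable {ℓ Mh k R : ℕ} {P : Fin (d + 1) → ℕ} (D : TDomains d ℓ Mh k P R) (a : ℕ → ℝ)

/-- **`P = I − R = G′Q′*(Q′G′²Q′*)⁻¹Q′G′` at U = 1 on the `k`-level TORUS family** — the printed word of (3.25) for `P`, with the
GENUINE multi-level torus `G′ = Δ′_a⁻¹ = gmlT`, `Q′ = QB D.toDomains`, `Q′* = QsB D.toDomains`, and `G` an operator on `𝔅`
standing for `(Q′G′²Q′*)⁻¹`. [cite: Balaban1985BackgroundPropagators, (3.25) p.394, p.399 («P = I − R»); Balaban1984PropagatorsII, p.235] -/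
def pProjMLT (G : Module.End ℝ (↥(bset D.toDomains) → ℝ)) : Module.End ℝ (↥(boxDom (N0 ℓ Mh k P)) → ℝ) :=
  Matrix.toLin' (gmlT (N0 ℓ Mh k P) ℓ k D.lev a) * (QsB D.toDomains ∘ₗ G ∘ₗ QB D.toDomains) * Matrix.toLin' (gmlT (N0 ℓ Mh k P) ℓ k D.lev a)

variable {D a}

/-- `Pf = G′(Q′*(G(Q′(G′f))))`. [cite: Balaban1985BackgroundPropagators, (3.25) p.394] -/
theorem pProjMLT_apply (G : Module.End ℝ (↥(bset D.toDomains) → ℝ)) (f : ↥(boxDom (N0 ℓ Mh k P)) → ℝ) :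
    pProjMLT D a G f = gmlT (N0 ℓ Mh k P) ℓ k D.lev a *ᵥ QsB D.toDomains (G (QB D.toDomains (gmlT (N0 ℓ Mh k P) ℓ k D.lev a *ᵥ f))) := by
  simp only [pProjMLT, Module.End.mul_apply, LinearMap.comp_apply, Matrix.toLin'_apply]

/-- **`R = 1 − P`**: the gauge-fixing projection `rProjMLT` of `B8Ineq192MultiLevelTorus` §5 IS `1 − pProjMLT` (p. 399 «the
operator P = I − R»). [cite: Balaban1985BackgroundPropagators, (3.25) p.394, p.399] -/
theorem rProjMLT_eq_one_sub_pProjMLT (G : Module.End ℝ (↥(bset D.toDomains) → ℝ)) :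
    rProjMLT D a G = 1 - pProjMLT D a G := rfl

/-- **`P² = P`** (P = I − R is a projection, [4] p. 394 / [B5] p. 25), from the inverse identity `(Q′G′²Q′*)·G = 1`: the middle
letters `Q′G′·G′Q′*` of `P·P` ARE `Q′G′²Q′*` (`QB_gmlT_gmlT_QsB`). [cite: Balaban1985BackgroundPropagators, (3.25) p.394; Balaban1984PropagatorsI, p.25] -/
theorem pProjMLT_idem {G : Module.End ℝ (↥(bset D.toDomains) → ℝ)} (hG : kerOp (W D.toDomains) (XkT D a) * G = 1)
    (f : ↥(boxDom (N0 ℓ Mh k P)) → ℝ) : pProjMLT D a G (pProjMLT D a G f) = pProjMLT D a G f := by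
  have h2 : ∀ v, kerOp (W D.toDomains) (XkT D a) (G v) = v := fun v => by
    have h := congrArg (fun T : Module.End ℝ (↥(bset D.toDomains) → ℝ) => T v) hG
    simpa only [Module.End.mul_apply, Module.End.one_apply] using h
  conv_lhs => rw [pProjMLT_apply]
  rw [pProjMLT_apply, QB_gmlT_gmlT_QsB, h2]

/-- **`P·R = 0`** (complementary projections), from the same identity. [cite: Balaban1985BackgroundPropagators, (3.25) p.394] -/
theorem pProjMLT_rProjMLT {G : Module.End ℝ (↥(bset D.toDomains) → ℝ)} (hG : kerOp (W D.toDomains) (XkT D a) * G = 1)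
    (f : ↥(boxDom (N0 ℓ Mh k P)) → ℝ) : pProjMLT D a G (rProjMLT D a G f) = 0 := by
  rw [rProjMLT_eq_one_sub_pProjMLT, LinearMap.sub_apply, Module.End.one_apply, map_sub, pProjMLT_idem hG, sub_self]

/-- a column of a matrix: `(Mδ_{x′})(w) = M(w, x′)`. [folklore] -/
private theorem mulVec_single_one_apply (M : Matrix ↥(boxDom (N0 ℓ Mh k P)) ↥(boxDom (N0 ℓ Mh k P)) ℝ)
    (w x' : ↥(boxDom (N0 ℓ Mh k P))) : (M *ᵥ Pi.single x' 1) w = M w x' := by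
  simp [Matrix.mulVec, dotProduct, Pi.single_apply]

/-- **THE SYMMETRY STEP, entry `G′`**: the column `x′` of `G′` is its row `x′` — `Δ′_a` is a quadratic form ((2.13)–(2.14)), so
`G′ᵀ = G′` (`gmlT_isSymm`). [cite: Balaban1984PropagatorsII, (2.13)–(2.14) p.225; Balaban1985BackgroundPropagators, p.391 («natural L² scalar products»)] -/
theorem col_gmlT_eq_row (x' : ↥(boxDom (N0 ℓ Mh k P))) :
    gmlT (N0 ℓ Mh k P) ℓ k (B6MultiLevelTorusOperatorL0.TDomains.lev D) a *ᵥ Pi.single x' 1 = fun w => gmlT (N0 ℓ Mh k P) ℓ k D.lev a x' w := by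
  funext w
  rw [mulVec_single_one_apply]
  exact (gmlT_isSymm (N := N0 ℓ Mh k P) (ℓ := ℓ) (k := k) (lev := D.lev) (a := a)).apply x' w

/-- **THE SYMMETRY STEP, entry `G′D*_ν`**: the column `x′` of `G′·D_νᵀ` is the row `x′` of `D_ν·G′` — `(G′D_νᵀ)ᵀ = D_νG′ᵀ = D_νG′`.
[cite: Balaban1984PropagatorsII, (2.13)–(2.14) p.225; Balaban1985BackgroundPropagators, p.391, (3.49) p.399 (entry (PD\*)_ν)] -/
theorem col_gmlT_transpose_eq_row (E : Matrix ↥(boxDom (N0 ℓ Mh k P)) ↥(boxDom (N0 ℓ Mh k P)) ℝ)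
    (x' : ↥(boxDom (N0 ℓ Mh k P))) :
    (gmlT (N0 ℓ Mh k P) ℓ k (B6MultiLevelTorusOperatorL0.TDomains.lev D) a * Eᵀ) *ᵥ Pi.single x' 1 =
      fun w => (E * gmlT (N0 ℓ Mh k P) ℓ k D.lev a) x' w := by
  funext w
  rw [mulVec_single_one_apply]
  have h : (E * gmlT (N0 ℓ Mh k P) ℓ k D.lev a)ᵀ =
      gmlT (N0 ℓ Mh k P) ℓ k D.lev a * Eᵀ := by
    rw [Matrix.transpose_mul, (gmlT_isSymm (N := N0 ℓ Mh k P) (ℓ := ℓ) (k := k) (lev := D.lev) (a := a)).eq]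
  rw [← h, Matrix.transpose_apply]

/-- `Eᵀδ_{x′}` fed to `G′`: `G′(Eᵀδ_{x′}) = (G′Eᵀ)δ_{x′}` = the row `x′` of `EG′` (`E = D_ν`). [folklore] -/
private theorem gmlT_mulVec_transpose_single (E : Matrix ↥(boxDom (N0 ℓ Mh k P)) ↥(boxDom (N0 ℓ Mh k P)) ℝ)
    (x' : ↥(boxDom (N0 ℓ Mh k P))) :
    gmlT (N0 ℓ Mh k P) ℓ k D.lev a *ᵥ (Eᵀ *ᵥ Pi.single x' 1) =
      fun w => (E * gmlT (N0 ℓ Mh k P) ℓ k D.lev a) x' w := by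
  rw [Matrix.mulVec_mulVec, col_gmlT_transpose_eq_row]

/-- **the matrix entry `P(x, x′) = (Pδ_{x′})(x)` written out**: `(Pδ_{x′})(x) = (G′·Q′*G Q′(row_{x′}G′))(x)`.
[cite: Balaban1985BackgroundPropagators, (3.25) p.394, (3.49) p.399] -/
theorem pProjMLT_single (G : Module.End ℝ (↥(bset D.toDomains) → ℝ)) (x' : ↥(boxDom (N0 ℓ Mh k P))) :
    pProjMLT D a G (Pi.single x' 1) =
      gmlT (N0 ℓ Mh k P) ℓ k D.lev a *ᵥ QsB D.toDomains (G (QB D.toDomains fun w => gmlT (N0 ℓ Mh k P) ℓ k D.lev a x' w)) := by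
  rw [pProjMLT_apply, col_gmlT_eq_row]

/-- **the matrix entry `(PD*_ν)(x, x′) = (P(D_νᵀδ_{x′}))(x)` written out**: `= (G′·Q′*G Q′(row_{x′}(D_νG′)))(x)`.
[cite: Balaban1985BackgroundPropagators, (3.25) p.394, (3.49) p.399] -/
theorem pProjMLT_transpose_single (G : Module.End ℝ (↥(bset D.toDomains) → ℝ))
    (E : Matrix ↥(boxDom (N0 ℓ Mh k P)) ↥(boxDom (N0 ℓ Mh k P)) ℝ) (x' : ↥(boxDom (N0 ℓ Mh k P))) :
    pProjMLT D a G (Eᵀ *ᵥ Pi.single x' 1) =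
      gmlT (N0 ℓ Mh k P) ℓ k D.lev a *ᵥ
        QsB D.toDomains (G (QB D.toDomains fun w => (E * gmlT (N0 ℓ Mh k P) ℓ k D.lev a) x' w)) := by
  rw [pProjMLT_apply, gmlT_mulVec_transpose_single]

end PProj

/-! ## §2  Row block sums under a Prop.-2.2 majorant; the `(L^{j′}η)^{−d}` gain of `Q′` on a row -/

section RowSums

variable {ℓ Mh k R : ℕ} {P : Fin (d + 1) → ℕ} {D : TDomains d ℓ Mh k P R}

/-- **a block majorant bounds the absolute row sums over the block** ((2.51)/(2.66) tested on the sign pattern of the row):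
if `T` has majorant `K` for the block map `y(·)`, then `Σ_{w∈B(y′)}|T(x, w)| ≦ K(y(x), y′)`. [cite: Balaban1984PropagatorsII, (2.51) p.232, (2.64)–(2.66) p.234] -/
theorem rowBlockSum_le_of_hasMajorantT {T : Matrix ↥(boxDom (N0 ℓ Mh k P)) ↥(boxDom (N0 ℓ Mh k P)) ℝ}
    {K : ↥(B6Geom246MultiLevelBoxL0.bset D.toDomains) → ↥(bset D.toDomains) → ℝ} (hT : HasMajorant (g := geomT D) (blkOf D.toDomains) (Matrix.toLin' T) K)
    (x : ↥(boxDom (N0 ℓ Mh k P))) (y' : ↥(bset D.toDomains)) :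
    ∑ w ∈ Finset.univ.filter (fun w => blkOf D.toDomains w = y'), |T x w| ≤ K (blkOf D.toDomains x) y' := by
  classical
  -- the test function: the sign pattern of the row `x` on the block `B(y′)`
  set μ : ↥(boxDom (N0 ℓ Mh k P)) → ℝ :=
    fun w => if blkOf D.toDomains w = y' then (if 0 ≤ T x w then 1 else -1) else 0 with hμ
  have hsupp : BlockSupp (g := geomT D) (blkOf D.toDomains) μ y' 1 := by
    refine ⟨zero_le_one, fun w hw => ?_, fun w hw => ?_⟩
    · have hw' : blkOf D.toDomains w = y' := hw
      simp only [hμ, hw', if_true]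
      split_ifs <;> simp
    · have hw' : ¬ blkOf D.toDomains w = y' := hw
      simp only [hμ]
      exact if_neg hw'
  have h := hT y' μ 1 hsupp x
  rw [mul_one, Matrix.toLin'_apply] at h
  have hsum : (T *ᵥ μ) x = ∑ w ∈ Finset.univ.filter (fun w => blkOf D.toDomains w = y'), |T x w| := by
    rw [Matrix.mulVec, dotProduct, Finset.sum_filter]
    refine Finset.sum_congr rfl fun w _ => ?_
    simp only [hμ]
    split_ifs with h1 h2
    · rw [mul_one, abs_of_nonneg h2]
    · rw [mul_neg, mul_one, abs_of_neg (lt_of_not_ge h2)]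
    · rw [mul_zero]
  rw [hsum] at h
  exact le_trans (le_abs_self _) h

/-- **THE `(L^{j′}η)^{−d}` GAIN: `Q′` applied to a ROW** — `|(Q′·row_{x′}T)(y′)| = W(y′)⁻¹|Σ_{w∈B(y′)}T(x′, w)| ≦ W(y′)⁻¹K(y(x′), y′)`
(the normalisation `(L^{j′}η)^{−(d+1)}` of the block mean survives, the block sum is paid by the majorant).
[cite: Balaban1984PropagatorsII, (2.14)–(2.15) p.225, (2.66) p.234; Balaban1985BackgroundPropagators, (3.49) p.399 (the factor (L^{j′}η)^{−d})] -/
theorem abs_QB_row_leT {T : Matrix ↥(boxDom (N0 ℓ Mh k P)) ↥(boxDom (N0 ℓ Mh k P)) ℝ}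
    {K : ↥(B6Geom246MultiLevelBoxL0.bset D.toDomains) → ↥(bset D.toDomains) → ℝ} (hT : HasMajorant (g := geomT D) (blkOf D.toDomains) (Matrix.toLin' T) K)
    (x' : ↥(boxDom (N0 ℓ Mh k P))) (y' : ↥(bset D.toDomains)) :
    |QB D.toDomains (fun w => T x' w) y'| ≤ (W D.toDomains y')⁻¹ * K (blkOf D.toDomains x') y' := by
  have hW := W_pos D.toDomains y'
  rw [QB_apply, abs_mul, abs_of_pos (inv_pos.2 hW)]
  refine mul_le_mul_of_nonneg_left ?_ (inv_nonneg.2 hW.le)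
  exact (Finset.abs_sum_le_sum_abs _ _).trans (rowBlockSum_le_of_hasMajorantT hT x' y')

end RowSums

/-! ## §3  The engine run: `T·Q′*·G·Q′·row_{x′}S` for a left factor `T` and a right row `S` with Prop.-2.2 majorants -/

section Kernel

/-- a negative real power of a positive length is the inverse of the natural power. [folklore] -/
private theorem rpow_neg_natCast_eq {x : ℝ} (hx : 0 < x) (n : ℕ) : x ^ (-(n : ℝ)) = (x ^ n)⁻¹ := by
  rw [Real.rpow_neg hx.le, Real.rpow_natCast]

/-- the same for the printed exponent `−4`. [folklore] -/
private theorem rpow_neg_four_eq {x : ℝ} (hx : 0 < x) : x ^ (-(4 : ℝ)) = (x ^ 4)⁻¹ := by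
  rw [show (-(4 : ℝ)) = -((4 : ℕ) : ℝ) by norm_num]
  exact rpow_neg_natCast_eq hx 4

/-- **THE ENGINE RUN FOR ONE WORD `T·Q′*G Q′·row_{x′}S` ON THE TORUS** (p. 399 «using again Lemma 2.1», realised with the flat
predecessors [B6] Prop. 2.3/Lemma 2.1 on `T_η`): for all `C, δ₀, C₁, δ₁ > 0` there are `ρ, B > 0`, `N₁ ≥ 1` such that for every `k`,
`M_h ≥ 1`, `R` with `R·L·M_h ≥ N₁ + 1`, every torus size `P`, every nested torus family `D` with (2.1)–(2.2), every weight sequence `a`,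
EVERY `G` on `𝔅` with the (2.87)-bound (constants `C₁, δ₁`), every left factor `T` with the Prop.-2.2-shape majorant `C(Lʲ)^{m}e^{−½δ₀d_T}`
and every fine matrix `S` with majorant `C(Lʲ)^{n}e^{−½δ₀d_T}` (`m, n ≤ 2`), and all points `x, x′` of the torus:
`|T(Q′*(G(Q′(row_{x′}S))))(x)| ≦ B·(Lʲ)^{m}(Lʲ)^{n}((Lʲ)⁴)⁻¹·W(y(x′))⁻¹·e^{−ρd(y(x),y(x′))}`, `j = D.lev x`.  Chain: `|Q′(row_{x′}S)(y′)| ≦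
W(y′)⁻¹C(L^{j′})ⁿe^{−½δ₀d(y(x′),y′)}` (§2); `|G(…)(y″)| ≦ C₁CL^{d+1}c·(L^{j′})ⁿ(L^{j″})⁻⁴W(y(x′))⁻¹e^{−ρ₁d}` ((2.87), the weight
`W(y′)⁻¹` moved to `y(x′)` by (2.60), summed by (2.61), (2.54)); `|T(Q′*…)(x)| ≦ …·CL⁴c·(Lʲ)^{m}(Lʲ)⁻⁴e^{−ρ₂d}` (Prop. 2.2, the
weight `(L^{j″})⁻⁴` moved to `y(x)`); finally `(L^{j′})ⁿ ≦ L²e^{σd}(Lʲ)ⁿ` ((2.60)). [cite: Balaban1985BackgroundPropagators, (3.49) p.399, (3.25) p.394; Balaban1984PropagatorsII, Prop. 2.2 (2.67) p.234, Prop. 2.3 (2.87) p.238, Lemma 2.1 (2.60)–(2.61) p.234, (2.52)–(2.55) p.232, (2.68) p.235] -/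
theorem pKernel_decay_T (d ℓ : ℕ) {C δ₀ C₁ δ₁ : ℝ} (hC : 0 < C) (hδ₀ : 0 < δ₀) (hC₁ : 0 < C₁) (hδ₁ : 0 < δ₁) :
    ∃ ρ B : ℝ, ∃ N₁ : ℕ, 0 < ρ ∧ 0 < B ∧ 0 < N₁ ∧
      ∀ (k Mh R : ℕ), 1 ≤ Mh → N₁ + 1 ≤ R * ((ℓ + 1) * Mh) →
      ∀ (P : Fin (d + 1) → ℕ) (_hP : ∀ μ, 1 ≤ P μ) (D : B6MultiLevelTorusOperatorL0.TDomains d ℓ Mh k P R) (a : ℕ → ℝ),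
        ∀ G : Module.End ℝ (↥(bset D.toDomains) → ℝ),
          (∀ y y' : ↥(bset D.toDomains), |mat G y y' / W D.toDomains y'| ≤
            C₁ * (geomT D).len y ^ (-(4 : ℝ)) * (geomT D).len y' ^ (-((d + 1 : ℕ) : ℝ)) *
              Real.exp (-(δ₁ / 2 * (geomT D).dist y y'))) →
          ∀ (T : Module.End ℝ (↥(boxDom (N0 ℓ Mh k P)) → ℝ))
            (S : Matrix ↥(boxDom (N0 ℓ Mh k P)) ↥(boxDom (N0 ℓ Mh k P)) ℝ) (m n : ℕ), m ≤ 2 → n ≤ 2 →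
            HasMajorant (g := geomT D) (blkOf D.toDomains) T
              (fun y y' => C * (geomT D).len y ^ m * Real.exp (-(δ₀ / 2 * (geomT D).dist y y'))) →
            HasMajorant (g := geomT D) (blkOf D.toDomains) (Matrix.toLin' S)
              (fun y y' => C * (geomT D).len y ^ n * Real.exp (-(δ₀ / 2 * (geomT D).dist y y'))) →
            ∀ x x' : ↥(boxDom (N0 ℓ Mh k P)),
              |T (QsB D.toDomains (G (QB D.toDomains fun w => S x' w))) x| ≤
                B * ((((ℓ : ℝ) + 1) ^ D.lev x.1) ^ m * (((ℓ : ℝ) + 1) ^ D.lev x.1) ^ n *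
                  ((((ℓ : ℝ) + 1) ^ D.lev x.1) ^ 4)⁻¹) * (W D.toDomains (blkOf D.toDomains x'))⁻¹ *
                  Real.exp (-(ρ * (geomT D).dist (blkOf D.toDomains x) (blkOf D.toDomains x'))) := by
  have hL0 : (0 : ℝ) < (ℓ : ℝ) + 1 := by positivity
  have hL1 : (1 : ℝ) ≤ (ℓ : ℝ) + 1 := by linarith [(Nat.cast_nonneg ℓ : (0 : ℝ) ≤ ℓ)]
  have hlog : Real.log ((ℓ : ℝ) + 1) ≤ (ℓ : ℝ) + 1 := (Real.log_le_sub_one_of_pos hL0).trans (by linarith)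
  have hlog0 : 0 ≤ Real.log ((ℓ : ℝ) + 1) := Real.log_nonneg hL1
  -- the rate unit `σ = min(δ₀, δ₁)/16` and the (2.59)-type threshold `N₁`
  obtain ⟨σ, hσ⟩ : ∃ σ : ℝ, σ = min (δ₀ / 16) (δ₁ / 16) := ⟨_, rfl⟩
  have hσ0 : 0 < σ := by rw [hσ]; exact lt_min (by positivity) (by positivity)
  have hσδ₀ : σ ≤ δ₀ / 16 := by rw [hσ]; exact min_le_left _ _
  have hσδ₁ : σ ≤ δ₁ / 16 := by rw [hσ]; exact min_le_right _ _
  obtain ⟨N₁, hN₁⟩ : ∃ N₁ : ℕ, N₁ = ⌈128 * ((d : ℝ) + 1) * ((ℓ : ℝ) + 1) / σ⌉₊ + 1 := ⟨_, rfl⟩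
  have hN₁pos : 0 < N₁ := by rw [hN₁]; omega
  have hN₁gt : 128 * ((d : ℝ) + 1) * ((ℓ : ℝ) + 1) < σ * (N₁ : ℝ) := by
    have h : 128 * ((d : ℝ) + 1) * ((ℓ : ℝ) + 1) / σ < (N₁ : ℝ) := by
      rw [hN₁]; push_cast
      exact lt_of_le_of_lt (Nat.le_ceil _) (by linarith)
    rw [div_lt_iff₀ hσ0] at h
    linarith
  -- the (2.61)-constant and the constant `B`
  obtain ⟨cK, hcK⟩ : ∃ cK : ℝ, cK = K261 N₁ (d + 1) ((ℓ : ℝ) + 1) 1 (1 * σ) := ⟨_, rfl⟩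
  have hcK0 : 0 ≤ cK := by rw [hcK]; exact K261_nonneg hL0.le zero_le_one
  obtain ⟨B, hB⟩ : ∃ B : ℝ, B = C₁ * C ^ 2 * ((ℓ : ℝ) + 1) ^ (d + 7) * cK ^ 2 := ⟨_, rfl⟩
  have hB0 : 0 ≤ B := by rw [hB]; positivity
  refine ⟨σ, B + 1, N₁, hσ0, by linarith, hN₁pos, ?_⟩
  intro k Mh R hMh1 hRM1 P hP D a G hG T S m n hm hn hT hS x x'
  have hRMone : 1 ≤ R * ((ℓ + 1) * Mh) := le_trans (by omega) hRM1
  have htri := (triangle_refl_nonneg_T D hMh1 hP).1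
  have hdnn := (triangle_refl_nonneg_T D hMh1 hP).2.2
  have hlen0 : ∀ y : ↥(bset D.toDomains), 0 ≤ (geomT D).len y := fun y => (lenT_pos D y).le
  -- Lemma 2.1 on the torus at the rate `σ`, and every larger rate
  have hθ : Real.exp (-(1 * σ)) * ((ℓ : ℝ) + 1) ^ ((2 * (d + 1 : ℕ) : ℝ) / N₁) < 1 := by
    refine theta_lt_one_of_log hL0 hN₁pos ?_
    push_cast
    nlinarith [mul_le_mul_of_nonneg_left hlog (by positivity : (0 : ℝ) ≤ 2 * ((d : ℝ) + 1))]
  obtain ⟨-, h261, -, -⟩ := lemma21_torus D hMh1 hP hN₁pos hRM1 hσ0.le (α := 1) zero_le_one le_rfl hθ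
  rw [← hcK] at h261
  have hrow : ∀ τ : ℝ, σ ≤ τ → ∀ y : (geomT D).Site,
      ∑ y'' : (geomT D).Site, Real.exp (-(τ * (geomT D).dist y y'')) ≤ cK := by
    intro τ hτ y
    have h := ineq261With_of_le (g := geomT D) h261 (δ' := τ) (α' := 1) (by linarith) hdnn y
    simpa only [one_mul] using h
  -- the thresholds `Lⁿ ≤ e^{β(RM−1)}` for `n ≤ d + 5` at every absorption rate `β ≥ σ`
  have hthr : ∀ (q : ℕ) (β : ℝ), q ≤ d + 5 → σ ≤ β →
      ((ℓ : ℝ) + 1) ^ q ≤ Real.exp (β * ((geomTB D).R * (geomTB D).M)) := by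
    intro q β hq hβ
    rw [geomTB_RM D hMh1]
    have hge : (N₁ : ℝ) ≤ (R : ℝ) * (((ℓ : ℝ) + 1) * Mh) - 1 := by
      have : ((N₁ + 1 : ℕ) : ℝ) ≤ ((R * ((ℓ + 1) * Mh) : ℕ) : ℝ) := by exact_mod_cast hRM1
      push_cast at this; linarith
    have hq' : (q : ℝ) ≤ (d : ℝ) + 5 := by exact_mod_cast hq
    have h4 : (q : ℝ) * Real.log ((ℓ : ℝ) + 1) ≤ β * ((R : ℝ) * (((ℓ : ℝ) + 1) * Mh) - 1) := by
      have h1 : σ * (N₁ : ℝ) ≤ β * ((R : ℝ) * (((ℓ : ℝ) + 1) * Mh) - 1) :=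
        calc σ * (N₁ : ℝ) ≤ β * (N₁ : ℝ) := mul_le_mul_of_nonneg_right hβ (Nat.cast_nonneg _)
          _ ≤ β * ((R : ℝ) * (((ℓ : ℝ) + 1) * Mh) - 1) := mul_le_mul_of_nonneg_left hge (by linarith)
      have hd0 : (0 : ℝ) ≤ (d : ℝ) := Nat.cast_nonneg d
      have hq0 : (0 : ℝ) ≤ (q : ℝ) := Nat.cast_nonneg q
      nlinarith [mul_le_mul_of_nonneg_left hlog hq0, mul_nonneg hd0 hlog0]
    calc ((ℓ : ℝ) + 1) ^ q = Real.exp ((q : ℝ) * Real.log ((ℓ : ℝ) + 1)) := by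
          rw [← Real.exp_log (pow_pos hL0 q), Real.log_pow]
      _ ≤ _ := Real.exp_le_exp.2 h4
  -- STEP R (§2): `|Q′(row_{x′}S)(y′)| ≤ W(y′)⁻¹·C(L^{j(x′)})ⁿ·e^{−½δ₀d(y(x′),y′)}`
  have hv : ∀ y' : ↥(bset D.toDomains), |QB D.toDomains (fun w => S x' w) y'| ≤
      (W D.toDomains y')⁻¹ * (C * (geomT D).len (blkOf D.toDomains x') ^ n * Real.exp (-(δ₀ / 2 * (geomT D).dist (blkOf D.toDomains x') y'))) :=
    fun y' => abs_QB_row_leT hS x' y'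
  -- STEP G ((2.87) on the column; the weight `W(y′)⁻¹ = (L^{j′})^{−(d+1)}` moved to `y(x′)` by (2.60), summed by (2.61))
  have hmat : ∀ y y' : ↥(bset D.toDomains), |mat G y y'| ≤
      C₁ * ((geomT D).len y ^ 4)⁻¹ * Real.exp (-(δ₁ / 2 * (geomT D).dist y y')) := by
    intro y y'
    have h := hG y y'
    have hWpos := W_pos D.toDomains y'
    have hW : W D.toDomains y' = (geomT D).len y' ^ (d + 1) := W_eq_lenT_pow D y'
    rw [abs_div, abs_of_pos hWpos, div_le_iff₀ hWpos, rpow_neg_four_eq (lenT_pos D y),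
      rpow_neg_natCast_eq (lenT_pos D y'), hW] at h
    calc |mat G y y'| ≤ _ := h
      _ = C₁ * ((geomT D).len y ^ 4)⁻¹ * Real.exp (-(δ₁ / 2 * (geomT D).dist y y')) *
            (((geomT D).len y' ^ (d + 1))⁻¹ * (geomT D).len y' ^ (d + 1)) := by ring
      _ = C₁ * ((geomT D).len y ^ 4)⁻¹ * Real.exp (-(δ₁ / 2 * (geomT D).dist y y')) := by
            rw [inv_mul_cancel₀ (pow_pos (lenT_pos D y') _).ne', mul_one]
  have hWinv : ∀ y y'' : (geomT D).Site, (W D.toDomains y'')⁻¹ ≤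
      ((ℓ : ℝ) + 1) ^ (d + 1) * Real.exp (2 * σ * (geomT D).dist y y'') * (W D.toDomains y)⁻¹ :=
    fun y y'' => by
      rw [W_eq_lenT_pow D y'', W_eq_lenT_pow D y]
      exact inv_pow_lenT_le hMh1 hP hRMone (d + 1) (by positivity) (hthr (d + 1) (2 * σ) (by omega) (by linarith)) y y''
  have hGv : ∀ y'' : ↥(bset D.toDomains), |G (QB D.toDomains fun w => S x' w) y''| ≤
      C₁ * C * ((ℓ : ℝ) + 1) ^ (d + 1) * cK * (geomT D).len (blkOf D.toDomains x') ^ n * (W D.toDomains (blkOf D.toDomains x'))⁻¹ *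
        ((geomT D).len y'' ^ 4)⁻¹ * Real.exp (-(4 * σ * (geomT D).dist (blkOf D.toDomains x') y'')) := by
    intro y''
    have hn4 : 0 ≤ C₁ * ((geomT D).len y'' ^ 4)⁻¹ := mul_nonneg hC₁.le (inv_nonneg.2 (pow_nonneg (hlen0 y'') 4))
    have hpn : 0 ≤ C * (geomT D).len (blkOf D.toDomains x') ^ n := mul_nonneg hC.le (pow_nonneg (hlen0 _) n)
    -- the mirrored 𝔅-convolution: `Σ_{y′}e^{−½δ₀d(y(x′),y′)}W(y′)⁻¹e^{−½δ₁d(y′,y″)} ≤ L^{d+1}c·W(y(x′))⁻¹e^{−4σd(y(x′),y″)}`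
    have h2 := levelConv_le (g := geomT D) htri hdnn (σ₁ := δ₀ / 2) (σ₂ := δ₁ / 2) (β := 2 * σ) (ρ := 4 * σ)
      (τ := 2 * σ) (A := ((ℓ : ℝ) + 1) ^ (d + 1)) (c := cK) (by positivity) (by linarith) (by linarith) (by positivity)
      (f := fun b => (W D.toDomains b)⁻¹) (fun b => inv_nonneg.2 (W_pos D.toDomains b).le) hWinv (hrow (2 * σ) (by linarith)) (blkOf D.toDomains x') y''
    have h2' : ∑ y' : ↥(bset D.toDomains), Real.exp (-(δ₀ / 2 * (geomT D).dist (blkOf D.toDomains x') y')) * (W D.toDomains y')⁻¹ *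
        Real.exp (-(δ₁ / 2 * (geomT D).dist y' y'')) ≤
        ((ℓ : ℝ) + 1) ^ (d + 1) * cK * (W D.toDomains (blkOf D.toDomains x'))⁻¹ * Real.exp (-(4 * σ * (geomT D).dist (blkOf D.toDomains x') y'')) := h2
    rw [apply_eq_sum_mat]
    calc |∑ y' : ↥(bset D.toDomains), mat G y'' y' * QB D.toDomains (fun w => S x' w) y'|
        ≤ ∑ y' : ↥(bset D.toDomains), |mat G y'' y' * QB D.toDomains (fun w => S x' w) y'| := Finset.abs_sum_le_sum_abs _ _
      _ ≤ ∑ y' : ↥(bset D.toDomains), C₁ * ((geomT D).len y'' ^ 4)⁻¹ * Real.exp (-(δ₁ / 2 * (geomT D).dist y'' y')) *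
            ((W D.toDomains y')⁻¹ * (C * (geomT D).len (blkOf D.toDomains x') ^ n *
              Real.exp (-(δ₀ / 2 * (geomT D).dist (blkOf D.toDomains x') y')))) := Finset.sum_le_sum fun y' _ => by
          rw [abs_mul]
          exact mul_le_mul (hmat y'' y') (hv y') (abs_nonneg _) (mul_nonneg hn4 (Real.exp_nonneg _))
      _ = C₁ * ((geomT D).len y'' ^ 4)⁻¹ * (C * (geomT D).len (blkOf D.toDomains x') ^ n) *
            ∑ y' : ↥(bset D.toDomains), Real.exp (-(δ₀ / 2 * (geomT D).dist (blkOf D.toDomains x') y')) * (W D.toDomains y')⁻¹ *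
              Real.exp (-(δ₁ / 2 * (geomT D).dist y' y'')) := by
          rw [Finset.mul_sum]
          refine Finset.sum_congr rfl fun y' _ => ?_
          have hs : (geomT D).dist y'' y' = (geomT D).dist y' y'' := symmT D y'' y'
          rw [hs]
          ring
      _ ≤ C₁ * ((geomT D).len y'' ^ 4)⁻¹ * (C * (geomT D).len (blkOf D.toDomains x') ^ n) *
            (((ℓ : ℝ) + 1) ^ (d + 1) * cK * (W D.toDomains (blkOf D.toDomains x'))⁻¹ *
              Real.exp (-(4 * σ * (geomT D).dist (blkOf D.toDomains x') y''))) :=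
          mul_le_mul_of_nonneg_left h2' (mul_nonneg hn4 hpn)
      _ = _ := by ring
  -- the column `u = Q′*(G(…))` on the fine lattice, decaying from `y(x′)` with the weight `(L^{j(z)})⁻⁴`
  obtain ⟨KR, hKR⟩ : ∃ KR : ℝ, KR = C₁ * C * ((ℓ : ℝ) + 1) ^ (d + 1) * cK * (geomT D).len (blkOf D.toDomains x') ^ n *
      (W D.toDomains (blkOf D.toDomains x'))⁻¹ := ⟨_, rfl⟩
  have hKR0 : 0 ≤ KR := by
    rw [hKR]
    exact mul_nonneg (mul_nonneg (by positivity) (pow_nonneg (hlen0 _) n)) (inv_nonneg.2 (W_pos D.toDomains _).le)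
  have hu : ∀ z : ↥(boxDom (N0 ℓ Mh k P)), |QsB D.toDomains (G (QB D.toDomains fun w => S x' w)) z| ≤
      KR * (((geomT D).len (blkOf D.toDomains z) ^ 4)⁻¹ * Real.exp (-(4 * σ * (geomT D).dist (blkOf D.toDomains z) (blkOf D.toDomains x')))) := by
    intro z
    have hs : (geomT D).dist (blkOf D.toDomains z) (blkOf D.toDomains x') = (geomT D).dist (blkOf D.toDomains x') (blkOf D.toDomains z) := symmT D _ _
    rw [QsB_apply, hKR, hs]
    have h := hGv (blkOf D.toDomains z)
    calc |G (QB D.toDomains fun w => S x' w) (blkOf D.toDomains z)| ≤ _ := h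
      _ = _ := by ring
  -- STEP L (Prop. 2.2 for `T`, the weight `(L^{j″})⁻⁴` moved to `y(x)` by (2.60), summed by (2.61), (2.54))
  have hf4 : ∀ y y'' : (geomT D).Site, ((geomT D).len y'' ^ 4)⁻¹ ≤
      ((ℓ : ℝ) + 1) ^ 4 * Real.exp (2 * σ * (geomT D).dist y y'') * ((geomT D).len y ^ 4)⁻¹ :=
    fun y y'' => inv_pow_lenT_le hMh1 hP hRMone 4 (by positivity) (hthr 4 (2 * σ) (by omega) (by linarith)) y y''
  have hTu : |T (QsB D.toDomains (G (QB D.toDomains fun w => S x' w))) x| ≤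
      KR * (C * ((ℓ : ℝ) + 1) ^ 4 * cK) * ((geomT D).len (blkOf D.toDomains x) ^ m * ((geomT D).len (blkOf D.toDomains x) ^ 4)⁻¹) *
        Real.exp (-(2 * σ * (geomT D).dist (blkOf D.toDomains x) (blkOf D.toDomains x'))) := by
    have h1 := abs_apply_le_of_levelBound (g := geomT D) (blkOf D.toDomains) hT
      (p := fun b => ((geomT D).len b ^ 4)⁻¹ * Real.exp (-(4 * σ * (geomT D).dist b (blkOf D.toDomains x')))) hKR0
      (fun b => mul_nonneg (inv_nonneg.2 (pow_nonneg (hlen0 b) 4)) (Real.exp_nonneg _)) hu x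
    have h2 := levelConv_le (g := geomT D) htri hdnn (σ₁ := δ₀ / 2) (σ₂ := 4 * σ) (β := 2 * σ) (ρ := 2 * σ)
      (τ := 2 * σ) (A := ((ℓ : ℝ) + 1) ^ 4) (c := cK) (by positivity) (by linarith) (by linarith) (by positivity)
      (f := fun b => ((geomT D).len b ^ 4)⁻¹) (fun b => inv_nonneg.2 (pow_nonneg (hlen0 b) 4)) hf4
      (hrow (2 * σ) (by linarith)) (blkOf D.toDomains x) (blkOf D.toDomains x')
    refine h1.trans ?_
    have hq : 0 ≤ C * (geomT D).len (blkOf D.toDomains x) ^ m := mul_nonneg hC.le (pow_nonneg (hlen0 _) m)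
    have hsum : ∑ b' : (geomT D).Site, C * (geomT D).len (blkOf D.toDomains x) ^ m *
          Real.exp (-(δ₀ / 2 * (geomT D).dist (blkOf D.toDomains x) b')) *
          (((geomT D).len b' ^ 4)⁻¹ * Real.exp (-(4 * σ * (geomT D).dist b' (blkOf D.toDomains x'))))
        = C * (geomT D).len (blkOf D.toDomains x) ^ m * ∑ b' : (geomT D).Site,
            Real.exp (-(δ₀ / 2 * (geomT D).dist (blkOf D.toDomains x) b')) * ((geomT D).len b' ^ 4)⁻¹ *
              Real.exp (-(4 * σ * (geomT D).dist b' (blkOf D.toDomains x'))) := by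
      rw [Finset.mul_sum]
      exact Finset.sum_congr rfl fun b' _ => by ring
    rw [hsum]
    calc KR * (C * (geomT D).len (blkOf D.toDomains x) ^ m * ∑ b' : (geomT D).Site,
          Real.exp (-(δ₀ / 2 * (geomT D).dist (blkOf D.toDomains x) b')) * ((geomT D).len b' ^ 4)⁻¹ *
            Real.exp (-(4 * σ * (geomT D).dist b' (blkOf D.toDomains x'))))
        ≤ KR * (C * (geomT D).len (blkOf D.toDomains x) ^ m * (((ℓ : ℝ) + 1) ^ 4 * cK * ((geomT D).len (blkOf D.toDomains x) ^ 4)⁻¹ *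
            Real.exp (-(2 * σ * (geomT D).dist (blkOf D.toDomains x) (blkOf D.toDomains x'))))) :=
          mul_le_mul_of_nonneg_left (mul_le_mul_of_nonneg_left h2 hq) hKR0
      _ = _ := by ring
  -- the right prefactor `(L^{j(x′)})ⁿ` moved to `y(x)` by (2.60): `(L^{j′})ⁿ ≤ Lⁿe^{σd(y(x),y(x′))}(Lʲ)ⁿ ≤ L²e^{σd}(Lʲ)ⁿ`
  have hpn : (geomT D).len (blkOf D.toDomains x') ^ n ≤
      ((ℓ : ℝ) + 1) ^ 2 * Real.exp (σ * (geomT D).dist (blkOf D.toDomains x) (blkOf D.toDomains x')) * (geomT D).len (blkOf D.toDomains x) ^ n := by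
    have h := pow_lenT_le hMh1 hP hRMone n hσ0.le (hthr n σ (by omega) le_rfl) (blkOf D.toDomains x) (blkOf D.toDomains x')
    refine h.trans (mul_le_mul_of_nonneg_right (mul_le_mul_of_nonneg_right (pow_le_pow_right₀ hL1 hn)
      (Real.exp_nonneg _)) (pow_nonneg (hlen0 _) n))
  -- assembly
  have hlx : (geomT D).len (blkOf D.toDomains x) = ((ℓ : ℝ) + 1) ^ D.lev x.1 := lenT_blkOf D x
  have hWx' : 0 < W D.toDomains (blkOf D.toDomains x') := W_pos D.toDomains _
  have hlenx : 0 < (geomT D).len (blkOf D.toDomains x) := lenT_pos D _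
  have hE : Real.exp (-(2 * σ * (geomT D).dist (blkOf D.toDomains x) (blkOf D.toDomains x'))) *
      Real.exp (σ * (geomT D).dist (blkOf D.toDomains x) (blkOf D.toDomains x')) =
      Real.exp (-(σ * (geomT D).dist (blkOf D.toDomains x) (blkOf D.toDomains x'))) := by
    rw [← Real.exp_add]; congr 1; ring
  refine hTu.trans ?_
  rw [hKR, ← hlx]
  -- everything but `len(y(x′))ⁿ` and the final exponential is a nonnegative scalar
  have hrest : 0 ≤ C₁ * C * ((ℓ : ℝ) + 1) ^ (d + 1) * cK * (W D.toDomains (blkOf D.toDomains x'))⁻¹ * (C * ((ℓ : ℝ) + 1) ^ 4 * cK) *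
      ((geomT D).len (blkOf D.toDomains x) ^ m * ((geomT D).len (blkOf D.toDomains x) ^ 4)⁻¹) *
      Real.exp (-(2 * σ * (geomT D).dist (blkOf D.toDomains x) (blkOf D.toDomains x'))) := by
    have h1 : 0 ≤ C₁ * C * ((ℓ : ℝ) + 1) ^ (d + 1) * cK := by positivity
    have h2 : 0 ≤ C₁ * C * ((ℓ : ℝ) + 1) ^ (d + 1) * cK * (W D.toDomains (blkOf D.toDomains x'))⁻¹ := mul_nonneg h1 (inv_nonneg.2 hWx'.le)
    have h3 : 0 ≤ C₁ * C * ((ℓ : ℝ) + 1) ^ (d + 1) * cK * (W D.toDomains (blkOf D.toDomains x'))⁻¹ * (C * ((ℓ : ℝ) + 1) ^ 4 * cK) :=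
      mul_nonneg h2 (by positivity)
    exact mul_nonneg (mul_nonneg h3 (mul_nonneg (pow_nonneg hlenx.le m) (inv_nonneg.2 (pow_nonneg hlenx.le 4))))
      (Real.exp_nonneg _)
  calc C₁ * C * ((ℓ : ℝ) + 1) ^ (d + 1) * cK * (geomT D).len (blkOf D.toDomains x') ^ n * (W D.toDomains (blkOf D.toDomains x'))⁻¹ *
        (C * ((ℓ : ℝ) + 1) ^ 4 * cK) * ((geomT D).len (blkOf D.toDomains x) ^ m * ((geomT D).len (blkOf D.toDomains x) ^ 4)⁻¹) *
        Real.exp (-(2 * σ * (geomT D).dist (blkOf D.toDomains x) (blkOf D.toDomains x')))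
      = C₁ * C * ((ℓ : ℝ) + 1) ^ (d + 1) * cK * (W D.toDomains (blkOf D.toDomains x'))⁻¹ * (C * ((ℓ : ℝ) + 1) ^ 4 * cK) *
        ((geomT D).len (blkOf D.toDomains x) ^ m * ((geomT D).len (blkOf D.toDomains x) ^ 4)⁻¹) *
        Real.exp (-(2 * σ * (geomT D).dist (blkOf D.toDomains x) (blkOf D.toDomains x'))) * (geomT D).len (blkOf D.toDomains x') ^ n := by ring
    _ ≤ C₁ * C * ((ℓ : ℝ) + 1) ^ (d + 1) * cK * (W D.toDomains (blkOf D.toDomains x'))⁻¹ * (C * ((ℓ : ℝ) + 1) ^ 4 * cK) *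
        ((geomT D).len (blkOf D.toDomains x) ^ m * ((geomT D).len (blkOf D.toDomains x) ^ 4)⁻¹) *
        Real.exp (-(2 * σ * (geomT D).dist (blkOf D.toDomains x) (blkOf D.toDomains x'))) *
        (((ℓ : ℝ) + 1) ^ 2 * Real.exp (σ * (geomT D).dist (blkOf D.toDomains x) (blkOf D.toDomains x')) * (geomT D).len (blkOf D.toDomains x) ^ n) :=
        mul_le_mul_of_nonneg_left hpn hrest
    _ = B * ((geomT D).len (blkOf D.toDomains x) ^ m * (geomT D).len (blkOf D.toDomains x) ^ n * ((geomT D).len (blkOf D.toDomains x) ^ 4)⁻¹) *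
        (W D.toDomains (blkOf D.toDomains x'))⁻¹ * Real.exp (-(σ * (geomT D).dist (blkOf D.toDomains x) (blkOf D.toDomains x'))) := by
        rw [hB, ← hE]; ring
    _ ≤ (B + 1) * ((geomT D).len (blkOf D.toDomains x) ^ m * (geomT D).len (blkOf D.toDomains x) ^ n * ((geomT D).len (blkOf D.toDomains x) ^ 4)⁻¹) *
        (W D.toDomains (blkOf D.toDomains x'))⁻¹ * Real.exp (-(σ * (geomT D).dist (blkOf D.toDomains x) (blkOf D.toDomains x'))) := by
        have h0 : 0 ≤ ((geomT D).len (blkOf D.toDomains x) ^ m * (geomT D).len (blkOf D.toDomains x) ^ n *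
            ((geomT D).len (blkOf D.toDomains x) ^ 4)⁻¹) * (W D.toDomains (blkOf D.toDomains x'))⁻¹ *
            Real.exp (-(σ * (geomT D).dist (blkOf D.toDomains x) (blkOf D.toDomains x'))) :=
          mul_nonneg (mul_nonneg (mul_nonneg (mul_nonneg (pow_nonneg hlenx.le m) (pow_nonneg hlenx.le n))
            (inv_nonneg.2 (pow_nonneg hlenx.le 4))) (inv_nonneg.2 hWx'.le)) (Real.exp_nonneg _)
        have : B * (((geomT D).len (blkOf D.toDomains x) ^ m * (geomT D).len (blkOf D.toDomains x) ^ n *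
            ((geomT D).len (blkOf D.toDomains x) ^ 4)⁻¹) * (W D.toDomains (blkOf D.toDomains x'))⁻¹ *
            Real.exp (-(σ * (geomT D).dist (blkOf D.toDomains x) (blkOf D.toDomains x')))) ≤ (B + 1) * _ :=
          mul_le_mul_of_nonneg_right (by linarith) h0
        simpa only [mul_assoc] using this

end Kernel

/-! ## §4  (3.49) at U = 1 on the `k`-level torus family: all four entries with the genuine level prefactors -/

section Main

/-- **(3.49) AT U = 1 ON THE `k`-LEVEL TORUS FAMILY — ALL FOUR ENTRIES, GENUINE LEVEL PREFACTORS, THE PROP.-2.2 MAJORANTS AND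
THE INVERSE ENTERING AS ARGUMENTS**: for all `C, δ₀, C₁, δ₁ > 0` there are `ρ, B > 0`, `N₁ ≥ 1` (functions of `d, ℓ, C, δ₀, C₁, δ₁`)
such that for every number of levels `k`, every `M_h ≥ 1`, every `R` with `R·L·M_h ≥ N₁ + 1`, every torus size `P`, every nested torus
family `D` of block-union domains with (2.1)–(2.2) (`Ω₁ = T_η`), every weight sequence `a` and every family `Dd μ` of fine matrices,
IF `G′ = gmlT` has the first-entry majorant `C·L^{2j}e^{−½δ₀d_T}` and each `Dd μ·G′` the second-entry majorant `C·Lʲe^{−½δ₀d_T}`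
([B6] Prop. 2.2 for this family: p21's `prop22_first/second_multiLevelTorus`, `Dd μ = dT N₀ μ`), THEN for EVERY operator `G` on `𝔅`
with `|G(y, y′)| ≦ C₁(Lʲ)⁻⁴(L^{j′})^{−(d+1)}e^{−½δ₁d_T(y,y′)}` (the printed bound (2.87) of [B6] Prop. 2.3 for `(Q′G′²Q′*)⁻¹`, in
the (2.69) convention `G(y, y′) = mat G y y′ / W(y′)`), and all points `x, x′` of the torus (blocks `y(x), y(x′)`, levels
`j = D.lev x`, `j′ = D.lev x′`, so `W(y(x′)) = (L^{j′})^{d+1}`) and axes `μ, ν`, for `P = G′Q′*GQ′G′` (`pProjMLT`), `D_μ = Dd μ`,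
`D*_ν = (Dd ν)ᵀ`: `|P(x,x′)| ≦ B·(L^{j′})^{−(d+1)}·e^{−ρd_T(y(x),y(x′))}`, `|(D_μP)(x,x′)| ≦ B(Lʲ)⁻¹(L^{j′})^{−(d+1)}e^{−ρd_T}`,
`|(PD*_ν)(x,x′)| ≦ B(Lʲ)⁻¹(L^{j′})^{−(d+1)}e^{−ρd_T}`, `|(D_μPD*_ν)(x,x′)| ≦ B(Lʲ)⁻²(L^{j′})^{−(d+1)}e^{−ρd_T}` — matrix entries
`T(x,x′) = (Tδ_{x′})(x)` of the genuine finite operators (at η = 1 the entry IS the kernel of the pairing of p. 391; print's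
`(L^{j′}η)^{−d}` in its `d` dimensions = `(L^{j′})^{−(d+1)}` here).  Mechanism (p. 399 «using again Lemma 2.1», [4] ↦ [B6] §2 at
U = 1 on `T_η`): §3 for the four words, the right row being `row_{x′}G′` (entries 1–2) or `row_{x′}(D_νG′)` (entries 3–4) by THE
SYMMETRY `G′ᵀ = G′` (§1, `gmlT_isSymm`). [cite: Balaban1985BackgroundPropagators, (3.49) p.399, (3.25) p.394, p.391; Balaban1984PropagatorsII, Prop. 2.2 (2.67) p.234, Prop. 2.3 (2.87) p.238, Lemma 2.1 (2.60)–(2.61) p.234, (2.52)–(2.55) p.232, (2.13)–(2.14) p.225, p.224 (Ω₁ = T_η admitted)] -/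
theorem ineq349_multiLevelTorus (d ℓ : ℕ) {C δ₀ C₁ δ₁ : ℝ} (hC : 0 < C) (hδ₀ : 0 < δ₀) (hC₁ : 0 < C₁) (hδ₁ : 0 < δ₁) :
    ∃ ρ B : ℝ, ∃ N₁ : ℕ, 0 < ρ ∧ 0 < B ∧ 0 < N₁ ∧
      ∀ (k Mh R : ℕ), 1 ≤ Mh → N₁ + 1 ≤ R * ((ℓ + 1) * Mh) →
      ∀ (P : Fin (d + 1) → ℕ) (_hP : ∀ μ, 1 ≤ P μ) (D : TDomains d ℓ Mh k P R) (a : ℕ → ℝ)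
        (Dd : Fin (d + 1) → Matrix ↥(boxDom (N0 ℓ Mh k P)) ↥(boxDom (N0 ℓ Mh k P)) ℝ),
        HasMajorant (g := geomT D) (blkOf D.toDomains) (Matrix.toLin' (gmlT (N0 ℓ Mh k P) ℓ k D.lev a))
          (fun y y' => C * ((ℓ : ℝ) + 1) ^ (2 * y.1.1) * Real.exp (-(δ₀ / 2 * (geomT D).dist y y'))) →
        (∀ μ : Fin (d + 1), HasMajorant (g := geomT D) (blkOf D.toDomains)
          (Matrix.toLin' (Dd μ * gmlT (N0 ℓ Mh k P) ℓ k D.lev a))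
          (fun y y' => C * ((ℓ : ℝ) + 1) ^ y.1.1 * Real.exp (-(δ₀ / 2 * (geomT D).dist y y')))) →
        ∀ G : Module.End ℝ (↥(bset D.toDomains) → ℝ),
          (∀ y y' : ↥(bset D.toDomains), |mat G y y' / W D.toDomains y'| ≤
            C₁ * (geomT D).len y ^ (-(4 : ℝ)) * (geomT D).len y' ^ (-((d + 1 : ℕ) : ℝ)) *
              Real.exp (-(δ₁ / 2 * (geomT D).dist y y'))) →
          ∀ (x x' : ↥(boxDom (N0 ℓ Mh k P))),
            |pProjMLT D a G (Pi.single x' 1) x| ≤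
              B * (W D.toDomains (blkOf D.toDomains x'))⁻¹ * Real.exp (-(ρ * (geomT D).dist (blkOf D.toDomains x) (blkOf D.toDomains x'))) ∧
            (∀ μ : Fin (d + 1), |(Dd μ *ᵥ pProjMLT D a G (Pi.single x' 1)) x| ≤
              B * (((ℓ : ℝ) + 1) ^ D.lev x.1)⁻¹ * (W D.toDomains (blkOf D.toDomains x'))⁻¹ *
                Real.exp (-(ρ * (geomT D).dist (blkOf D.toDomains x) (blkOf D.toDomains x')))) ∧
            (∀ ν : Fin (d + 1), |pProjMLT D a G ((Dd ν)ᵀ *ᵥ Pi.single x' 1) x| ≤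
              B * (((ℓ : ℝ) + 1) ^ D.lev x.1)⁻¹ * (W D.toDomains (blkOf D.toDomains x'))⁻¹ *
                Real.exp (-(ρ * (geomT D).dist (blkOf D.toDomains x) (blkOf D.toDomains x')))) ∧
            (∀ μ ν : Fin (d + 1),
              |(Dd μ *ᵥ pProjMLT D a G ((Dd ν)ᵀ *ᵥ Pi.single x' 1)) x| ≤
              B * ((((ℓ : ℝ) + 1) ^ D.lev x.1) ^ 2)⁻¹ * (W D.toDomains (blkOf D.toDomains x'))⁻¹ *
                Real.exp (-(ρ * (geomT D).dist (blkOf D.toDomains x) (blkOf D.toDomains x')))) := by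
  obtain ⟨ρ, B, N₁, hρ, hB, hN₁, h⟩ := pKernel_decay_T d ℓ hC hδ₀ hC₁ hδ₁
  refine ⟨ρ, B, N₁, hρ, hB, hN₁, ?_⟩
  intro k Mh R hMh1 hRM1 P hP D a Dd hTG0 hTD0 G hG x x'
  have key := h k Mh R hMh1 hRM1 P hP D a G hG
  have hL0 : (0 : ℝ) < (ℓ : ℝ) + 1 := by positivity
  -- the Prop.-2.2 majorants with the lengths `(geomT D).len`
  have hTG : HasMajorant (g := geomT D) (blkOf D.toDomains) (Matrix.toLin' (gmlT (N0 ℓ Mh k P) ℓ k D.lev a))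
      (fun y y' => C * (geomT D).len y ^ 2 * Real.exp (-(δ₀ / 2 * (geomT D).dist y y'))) := by
    refine hasMajorant_mono (g := geomT D) (blkOf D.toDomains) hTG0 fun y y' => le_of_eq ?_
    rw [lenT_eq, ← pow_mul, Nat.mul_comm]
  have hTD : ∀ μ : Fin (d + 1), HasMajorant (g := geomT D) (blkOf D.toDomains)
      (Matrix.toLin' (Dd μ * gmlT (N0 ℓ Mh k P) ℓ k D.lev a))
      (fun y y' => C * (geomT D).len y ^ 1 * Real.exp (-(δ₀ / 2 * (geomT D).dist y y'))) := by
    intro μ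
    refine hasMajorant_mono (g := geomT D) (blkOf D.toDomains) (hTD0 μ) fun y y' => le_of_eq ?_
    rw [lenT_eq, pow_one]
  set lam : ℝ := ((ℓ : ℝ) + 1) ^ D.lev x.1 with hlam
  have hlam0 : 0 < lam := pow_pos hL0 _
  have hW0 : 0 ≤ (W D.toDomains (blkOf D.toDomains x'))⁻¹ := inv_nonneg.2 (W_pos D.toDomains _).le
  have hE : 0 ≤ Real.exp (-(ρ * (geomT D).dist (blkOf D.toDomains x) (blkOf D.toDomains x'))) := Real.exp_nonneg _
  -- the composite `∂_μ·G′` as an endomorphism and its action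
  have hDe : ∀ (μ : Fin (d + 1)) (u : ↥(boxDom (N0 ℓ Mh k P)) → ℝ),
      (Matrix.toLin' (Dd μ * gmlT (N0 ℓ Mh k P) ℓ k D.lev a)) u =
        Dd μ *ᵥ (gmlT (N0 ℓ Mh k P) ℓ k D.lev a *ᵥ u) := fun μ u => by
    rw [Matrix.toLin'_apply, Matrix.mulVec_mulVec]
  refine ⟨?_, fun μ => ?_, fun ν => ?_, fun μ ν => ?_⟩
  · -- entry 1: `T = G′` (m = 2), row `G′` (n = 2): prefactor `λ²λ²λ⁻⁴ = 1`
    have h := key (Matrix.toLin' (gmlT (N0 ℓ Mh k P) ℓ k D.lev a)) (gmlT (N0 ℓ Mh k P) ℓ k D.lev a) 2 2 le_rfl le_rfl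
      hTG hTG x x'
    rw [Matrix.toLin'_apply] at h
    rw [pProjMLT_single]
    refine h.trans (le_of_eq ?_)
    rw [← hlam]
    field_simp
  · -- entry 2: `T = ∂_μG′` (m = 1), row `G′` (n = 2): prefactor `λλ²λ⁻⁴ = λ⁻¹`
    have h := key (Matrix.toLin' (Dd μ * gmlT (N0 ℓ Mh k P) ℓ k D.lev a))
      (gmlT (N0 ℓ Mh k P) ℓ k D.lev a) 1 2 (by norm_num) le_rfl (hTD μ) hTG x x'
    rw [hDe] at h
    rw [pProjMLT_single]
    refine h.trans (le_of_eq ?_)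
    rw [← hlam]
    field_simp
  · -- entry 3: `T = G′` (m = 2), row `∂_νG′` (n = 1): prefactor `λ²λλ⁻⁴ = λ⁻¹`
    have h := key (Matrix.toLin' (gmlT (N0 ℓ Mh k P) ℓ k D.lev a))
      (Dd ν * gmlT (N0 ℓ Mh k P) ℓ k D.lev a) 2 1 le_rfl (by norm_num) hTG (hTD ν) x x'
    rw [Matrix.toLin'_apply] at h
    rw [pProjMLT_transpose_single]
    refine h.trans (le_of_eq ?_)
    rw [← hlam]
    field_simp
  · -- entry 4: `T = ∂_μG′` (m = 1), row `∂_νG′` (n = 1): prefactor `λλλ⁻⁴ = λ⁻²`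
    have h := key (Matrix.toLin' (Dd μ * gmlT (N0 ℓ Mh k P) ℓ k D.lev a))
      (Dd ν * gmlT (N0 ℓ Mh k P) ℓ k D.lev a) 1 1 (by norm_num) (by norm_num) (hTD μ) (hTD ν) x x'
    rw [hDe] at h
    rw [pProjMLT_transpose_single]
    refine h.trans (le_of_eq ?_)
    rw [← hlam]
    field_simp

/-- **the same four bounds for the off-identity part of `R` ((3.25)) on the torus, `R − 1 = −P`** — the form in which (3.49) is
consumed for «the operator R, or DRD\*» (p. 399, l. 5); same hypotheses as `ineq349_multiLevelTorus`.
[cite: Balaban1985BackgroundPropagators, (3.49) p.399, (3.25) p.394] -/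
theorem ineq349_multiLevelTorus_R (d ℓ : ℕ) {C δ₀ C₁ δ₁ : ℝ} (hC : 0 < C) (hδ₀ : 0 < δ₀) (hC₁ : 0 < C₁) (hδ₁ : 0 < δ₁) :
    ∃ ρ B : ℝ, ∃ N₁ : ℕ, 0 < ρ ∧ 0 < B ∧ 0 < N₁ ∧
      ∀ (k Mh R : ℕ), 1 ≤ Mh → N₁ + 1 ≤ R * ((ℓ + 1) * Mh) →
      ∀ (P : Fin (d + 1) → ℕ) (_hP : ∀ μ, 1 ≤ P μ) (D : B6MultiLevelTorusOperatorL0.TDomains d ℓ Mh k P R) (a : ℕ → ℝ)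
        (Dd : Fin (d + 1) → Matrix ↥(boxDom (N0 ℓ Mh k P)) ↥(boxDom (N0 ℓ Mh k P)) ℝ),
        HasMajorant (g := geomT D) (blkOf D.toDomains) (Matrix.toLin' (gmlT (N0 ℓ Mh k P) ℓ k D.lev a))
          (fun y y' => C * ((ℓ : ℝ) + 1) ^ (2 * y.1.1) * Real.exp (-(δ₀ / 2 * (geomT D).dist y y'))) →
        (∀ μ : Fin (d + 1), HasMajorant (g := geomT D) (blkOf D.toDomains)
          (Matrix.toLin' (Dd μ * gmlT (N0 ℓ Mh k P) ℓ k D.lev a))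
          (fun y y' => C * ((ℓ : ℝ) + 1) ^ y.1.1 * Real.exp (-(δ₀ / 2 * (geomT D).dist y y')))) →
        ∀ G : Module.End ℝ (↥(bset D.toDomains) → ℝ),
          (∀ y y' : ↥(bset D.toDomains), |mat G y y' / W D.toDomains y'| ≤
            C₁ * (geomT D).len y ^ (-(4 : ℝ)) * (geomT D).len y' ^ (-((d + 1 : ℕ) : ℝ)) *
              Real.exp (-(δ₁ / 2 * (geomT D).dist y y'))) →
          ∀ (x x' : ↥(boxDom (N0 ℓ Mh k P))),
            |(rProjMLT D a G - 1) (Pi.single x' 1) x| ≤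
              B * (W D.toDomains (blkOf D.toDomains x'))⁻¹ * Real.exp (-(ρ * (geomT D).dist (blkOf D.toDomains x) (blkOf D.toDomains x'))) ∧
            (∀ μ : Fin (d + 1), |(Dd μ *ᵥ (rProjMLT D a G - 1) (Pi.single x' 1)) x| ≤
              B * (((ℓ : ℝ) + 1) ^ D.lev x.1)⁻¹ * (W D.toDomains (blkOf D.toDomains x'))⁻¹ *
                Real.exp (-(ρ * (geomT D).dist (blkOf D.toDomains x) (blkOf D.toDomains x')))) ∧
            (∀ ν : Fin (d + 1), |(rProjMLT D a G - 1) ((Dd ν)ᵀ *ᵥ Pi.single x' 1) x| ≤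
              B * (((ℓ : ℝ) + 1) ^ D.lev x.1)⁻¹ * (W D.toDomains (blkOf D.toDomains x'))⁻¹ *
                Real.exp (-(ρ * (geomT D).dist (blkOf D.toDomains x) (blkOf D.toDomains x')))) ∧
            (∀ μ ν : Fin (d + 1),
              |(Dd μ *ᵥ (rProjMLT D a G - 1) ((Dd ν)ᵀ *ᵥ Pi.single x' 1)) x| ≤
              B * ((((ℓ : ℝ) + 1) ^ D.lev x.1) ^ 2)⁻¹ * (W D.toDomains (blkOf D.toDomains x'))⁻¹ *
                Real.exp (-(ρ * (geomT D).dist (blkOf D.toDomains x) (blkOf D.toDomains x')))) := by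
  obtain ⟨ρ, B, N₁, hρ, hB, hN₁, h⟩ := ineq349_multiLevelTorus d ℓ hC hδ₀ hC₁ hδ₁
  refine ⟨ρ, B, N₁, hρ, hB, hN₁, ?_⟩
  intro k Mh R hMh1 hRM1 P hP D a Dd hTG hTD G hG x x'
  obtain ⟨h1, h2, h3, h4⟩ := h k Mh R hMh1 hRM1 P hP D a Dd hTG hTD G hG x x'
  have hsub : rProjMLT D a G - 1 = -pProjMLT D a G := by
    rw [rProjMLT_eq_one_sub_pProjMLT]; abel
  simp only [hsub, LinearMap.neg_apply, Pi.neg_apply, abs_neg, Matrix.mulVec_neg]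
  exact ⟨h1, h2, h3, h4⟩

end Main

end

end Literature.MathematicalPhysics.QuantumFieldTheory.Balaban1983to89.B9Ineq349MultiLevelTorusL0
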